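import Summits.ValiantsHypothesis.ValiantsHypothesis.Theorems.KPlusLogSqLawTropicalWalkDesignIncidences

/-!
# Route «KPlusLogSqLaw», crux `WeakLifting` (stmt-ValiantsHypothesis-19561), docket D2 — INCIDENCE-LINEAR LAWS ARE FALSE AT `K = 4`
# (part 2: the staircase design has fewer than `3m` present incidences and `n^L − 1` alternations)

HONEST FRAMING.  Helper file (cell `pub-symmetroid`, seat val-sym-lift-p3 g26, 2026-08-29) `--supports` the crux `…Theses.KPlusLogSqLaw.WeakLifting`
(item `stmt-ValiantsHypothesis-19561`; lineage docket D2).  A NEGATIVE structure result about the tropical census, obtained by COUNTING the present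
incidences of a family already in the tree (the staircase walk design, `…TropicalBStaircaseDesign.staircase_lower` / `DPR.stub_stair`, seat
val-sym-trop-p1); nothing new is claimed about the staircase's chain (the walk-system part is the tree's `le_of_walkSystem`, unpacked so that the design
stays in hand); nothing is asserted about `WeakLifting`, `TropicalB`, `Lifting`, `TropK4Law 2`, `KPlusLogSqLaw`, `MatrixDescartes`
(stmt-ValiantsHypothesis-18050) or VP ≠ VNP.  No `def`.
WHY.  By the fresh-incidence law (`…TropicalFreshIncidences.le_card_used_add_card_recomb`: `n + m ≤ #used incidences + Z`, `Z` = recombination steps)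
the cell's `TropK4Law 2` is «`Z = O(m²)`», and every kernel census chain of the `K = 4` column has `n ≤ #incidences` (lineage g25 census); the
reframing «S(4): every `K = 4` design has at most `C·#present incidences` alternations» (README g25 (b)) would give `TropK4Law 2`.  THIS FILE KILLS S(4):
* `stub_stair_explicit` — the tree's `DPR.stub_stair` with its layered graph NAMED (`(gad n L L 0).map (finLayer (2^L n))`; proof verbatim);
* `staircase_design` — for `n ≥ 2` even, `L ≥ 1`: an explicit design of format `(m, L+1)`, `m = ((2^L − 1)(n+1) + 1)·(2^L·n·2)`, with a sign-alternating
  chain of `n^L` dominant terms AND at most `(3(2^L − 1)(n+1) + 2)·(2^L·n·2) < 3m` present incidences (part 1's `card_support_walkEps_le` +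
  `card_edges_staircase_layer_le`);
* `staircase_four` (`L = 3`): `n³` alternating dominant terms on at most `336n² + 368n` incidences; `final_arith`;
* **`exists_chain_gt_mul_card_incidences`** — for EVERY `C` there is a `K = 4` design (the staircase with `n = 800(C+1)`) whose alternating dominant
  chain has MORE than `C × #present incidences` alternations.
READING (located context, not claimed beyond the statements): at `K = 4` the recombination count `Z` of a dominant chain is not bounded by any multiple
of the number of incidences — along the staircase `Z ≥ n³ − 336n² − 368n − 1`, asymptotically almost every step is a recombination — while the chain
length `Θ(m^{3/2})` stays `o(m²)`: «`Z = O(m²)`» cannot come from an incidence-linear bound, and the located regularities of the `K = 4` census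
(`Z ≤ 7`, `n/#used ≤ 0.9`, memo `HOME/val-sym-lift-p3/g26/memo/REACH-MEAN-AND-PROBES-liftp3g26.md` §5) are small-`m` phenomena (the first staircase
instance with more alternations than incidences has `n > 704`, `m ≈ 5.6·10⁷`).
[folklore counting over the cited tree constructions; the staircase is Carstensen 1983 / Mulmuley–Shah 2001 as built in the tree]
-/

set_option linter.dupNamespace false
set_option autoImplicit false

namespace Summit.ValiantsHypothesis.ValiantsHypothesis.Theorems.KPlusLogSqLaw

open Summit.ValiantsHypothesis.ValiantsHypothesis.Theorems.MatrixDescartes.Negative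
open Summit.ValiantsHypothesis.ValiantsHypothesis.Theorems.SymmetroidDescartes.DPR
open Summit.ValiantsHypothesis.ValiantsHypothesis.Theorems.KPlusLogSqLaw.WalkDesign
open scoped BigOperators
open Finset

namespace StaircaseIncidences

/-! ## 3. The staircase walk system with its EXPLICIT layered graph (the tree's `stub_stair`, graph named) -/

section Staircase

/-- the tree's `DPR.stub_stair` with the layered graph made explicit: `g = (gad n L L 0).map (finLayer (2^L n))`.  (Proof verbatim
from the tree; only the packaging differs.) -/
theorem stub_stair_explicit (n L N : ℕ) (hn : 2 ≤ n) (he : Even n) (hL : 1 ≤ L) (hN : N + 1 = n ^ L) :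
    ∃ (d : Fin (L + 1) → ℕ) (v₀ : Fin (2 ^ L * n) × Bool) (lam : Fin (N + 1) → ℤ)
      (wstar : Fin (N + 1) → List (Fin (2 ^ L * n) × Bool)) (c : Fin (N + 1) → ℤ),
      StrictMono lam ∧
      (∀ j, walkCost d (lam j) ((gad n L L 0).map (finLayer (2 ^ L * n))) v₀ (wstar j) = (c j : WithTop ℤ)) ∧
      (∀ j (w : List (Fin (2 ^ L * n) × Bool)), w ≠ wstar j →
        ((c j + 1 : ℤ) : WithTop ℤ) ≤ walkCost d (lam j) ((gad n L L 0).map (finLayer (2 ^ L * n))) v₀ w) ∧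
      (∀ j, walkSign ((gad n L L 0).map (finLayer (2 ^ L * n))) v₀ (wstar j) = (-1) ^ (j : ℕ)) := by
  have hn1 : 1 ≤ n := by omega
  set R : ℕ := 2 ^ L * n with hRdef
  have hR : 0 < R := by positivity
  have hrows : ∀ j, ∀ v ∈ canon n L L 0 0 j, v.1 < R := by
    intro j v hv
    have h1 := rows_canon n L L 0 0 j v hv
    have h2 := sig_le' n hn1 L j
    have h3 : 1 ≤ 2 ^ L := Nat.one_le_two_pow
    have h4 : (2 ^ L - 1) * (n - 1) < 2 ^ L * n := by
      zify [h3, hn1]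
      nlinarith
    omega
  have hmap : ∀ j, ((canon n L L 0 0 j).map (liftV R hR)).map (iota R) = canon n L L 0 0 j := by
    intro j
    rw [List.map_map]
    conv_rhs => rw [← List.map_id (canon n L L 0 0 j)]
    refine List.map_congr_left fun v hv => ?_
    exact iota_liftV R hR v (hrows j v hv)
  refine ⟨expo n L, (⟨0, hR⟩, false), fun j => lamOf n L j,
    fun j => (canon n L L 0 0 j).map (liftV R hR), fun j => val n L L 0 0 j (lamOf n L j), ?_, ?_, ?_, ?_⟩
  · intro a b hab
    exact lamOf_lt n L hn1 a b hab (by rw [← hN]; exact b.isLt)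
  · intro j
    rw [walkCost_finLayer, hmap]
    exact walkCost_canon n L hn1 _ L le_rfl 0 0 j
  · intro j w hw
    rw [walkCost_finLayer]
    have hne : w.map (iota R) ≠ canon n L L 0 0 j := by
      intro h
      apply hw
      rw [← hmap j] at h
      exact (List.map_injective_iff.2 (iota_injective R)) h
    have hlaw := law_all n L hn1 L le_rfl 0 0 j (lamOf n L j) (by simp) (by simpa using layers_le_Rtot n L)
      (inCore_lamOf n L j) _ hne
    have hg := one_le_gapZ_top n L
    refine le_trans ?_ hlaw
    exact_mod_cast (by linarith : val n L L 0 0 j (lamOf n L j) + 1 ≤ val n L L 0 0 j (lamOf n L j) + gapZ n L L)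
  · intro j
    rw [walkSign_finLayer, hmap]
    show walkSign (gad n L L 0) (0, false) (canon n L L 0 0 j) = (-1) ^ (j : ℕ)
    rw [walkSign_canon_top n L hn1 hL]
    conv_rhs => rw [← Nat.div_add_mod (j : ℕ) n, pow_add, pow_mul, Even.neg_one_pow he, one_pow, one_mul]

/-- **The staircase as a tropical design WITH ITS INCIDENCE COUNT.**  For `n ≥ 2` even and `L ≥ 1`: a dominance design of format
`(m, L+1)`, `m = ((2^L − 1)(n+1) + 1)·(2^L·n·2)`, with a sign-alternating chain of `n^L` dominant terms at strictly increasing integer slopes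
and AT MOST `(3(2^L − 1)(n+1) + 2)·(2^L·n·2)` present incidences (so fewer than `3m`). -/
theorem staircase_design (n L : ℕ) (hn : 2 ≤ n) (he : Even n) (hL : 1 ≤ L) :
    ∃ (m : ℕ) (d : Fin (L + 1) → ℕ) (v ε : Fin m → Fin m → Fin (L + 1) → ℤ) (N : ℕ) (θ : Fin (N + 1) → ℤ)
      (p : Fin (N + 1) → Equiv.Perm (Fin m) × (Fin m → Fin (L + 1))),
      N + 1 = n ^ L ∧ m = ((2 ^ L - 1) * (n + 1) + 1) * (2 ^ L * n * 2) ∧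
      (∀ i j l, (ε i j l).natAbs ≤ 1) ∧ StrictMono θ ∧ (∀ k, IsDominant d v ε (θ k) (p k)) ∧
      (∀ k : Fin N, termSign ε (p k.castSucc) * termSign ε (p k.succ) < 0) ∧
      ((univ : Finset (Fin m × Fin m × Fin (L + 1))).filter (fun x => ε x.1 x.2.1 x.2.2 ≠ 0)).card
        ≤ (3 * ((2 ^ L - 1) * (n + 1)) + 2) * (2 ^ L * n * 2) := by
  classical
  have hn1 : 1 ≤ n := by omega
  set N := n ^ L - 1 with hNdef
  have hN : N + 1 = n ^ L := Nat.sub_add_cancel (Nat.one_le_pow _ _ (by omega))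
  obtain ⟨d, v₀, lam, wstar, c, hlam, hcost, hmarg, hsign⟩ := stub_stair_explicit n L N hn he hL hN
  set g := (gad n L L 0).map (finLayer (2 ^ L * n)) with hgdef
  have hlen : g.length = (2 ^ L - 1) * (n + 1) := by rw [hgdef, List.length_map, length_gad n L hn1]
  have hK : 0 < L + 1 := Nat.succ_pos L
  have hT : 0 < g.length := by
    rw [hlen]
    have : 1 ≤ 2 ^ L - 1 := by
      have : 2 ≤ 2 ^ L := by
        calc 2 = 2 ^ 1 := by norm_num
          _ ≤ 2 ^ L := Nat.pow_le_pow_right (by norm_num) hL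
      omega
    positivity
  have hm : (g.length + 1) * Fintype.card (Fin (2 ^ L * n) × Bool) = ((2 ^ L - 1) * (n + 1) + 1) * (2 ^ L * n * 2) := by
    rw [hlen, Fintype.card_prod, Fintype.card_fin, Fintype.card_bool]
  have hWval : Fintype.card (Fin (2 ^ L * n) × Bool) = 2 ^ L * n * 2 := by
    rw [Fintype.card_prod, Fintype.card_fin, Fintype.card_bool]
  -- (verbatim from the tree's `le_of_walkSystem`)
  set T := g.length with hTdef
  set lay : Fin T → (Fin (2 ^ L * n) × Bool) → (Fin (2 ^ L * n) × Bool) → Option (WEdge (L + 1)) := g.get with hlay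
  set l₀ : Fin (L + 1) := ⟨0, hK⟩ with hl₀
  set W := Fintype.card (Fin (2 ^ L * n) × Bool) with hW
  set ι : Fin (T + 1) × (Fin (2 ^ L * n) × Bool) ≃ Fin ((T + 1) * W) :=
    (Equiv.prodCongr (Equiv.refl (Fin (T + 1))) (Fintype.equivFin _)).trans finProdFinEquiv with hι
  have hne : ∀ j, walkCost d (lam j) g v₀ (wstar j) ≠ ⊤ := fun j => by rw [hcost]; exact WithTop.coe_ne_top
  choose y hy0 hys hyw using fun j => exists_walk_of_walkCost_ne_top d (lam j) g v₀ (wstar j) (hne j)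
  have hwalk : ∀ j, IsLayWalk lay v₀ (y j) := fun j => ⟨hy0 j, hys j⟩
  have hcostFin : ∀ j, walkCostFin d lay (lam j) (y j) = c j := by
    intro j
    have h1 := walkCost_ofFn d (lam j) g (y j) (hys j)
    rw [hy0 j, hyw j, hcost j] at h1
    exact (WithTop.coe_eq_coe.mp h1).symm
  have hsgnFin : ∀ j, walkSgnFin lay (y j) = (-1) ^ (j : ℕ) := by
    intro j
    have h1 := walkSign_ofFn g (y j)
    rw [hy0 j, hyw j, hsign j] at h1
    exact h1.symm
  set Ω : ℤ := 1 + ∑ j, (|c j| + (T : ℤ) * |lam j| * (d l₀ : ℤ)) with hΩ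
  have hΩj : ∀ j, walkCostFin d lay (lam j) (y j) + (T : ℤ) * (lam j * (d l₀ : ℤ)) < Ω := by
    intro j
    rw [hcostFin]
    have h1 : |c j| + (T : ℤ) * |lam j| * (d l₀ : ℤ) ≤ ∑ j, (|c j| + (T : ℤ) * |lam j| * (d l₀ : ℤ)) :=
      Finset.single_le_sum (f := fun j => |c j| + (T : ℤ) * |lam j| * (d l₀ : ℤ))
        (fun i _ => by positivity) (mem_univ j)
    have h2 : c j ≤ |c j| := le_abs_self _
    have h3 : (T : ℤ) * (lam j * (d l₀ : ℤ)) ≤ (T : ℤ) * |lam j| * (d l₀ : ℤ) := by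
      have : lam j * (d l₀ : ℤ) ≤ |lam j| * (d l₀ : ℤ) :=
        mul_le_mul_of_nonneg_right (le_abs_self _) (by positivity)
      nlinarith
    omega
  set pp : Fin (N + 1) → Equiv.Perm (Fin ((T + 1) * W)) × (Fin ((T + 1) * W) → Fin (L + 1)) :=
    fun j => walkTerm ι lay l₀ (y j) with hpp
  refine ⟨(T + 1) * W, d, walkVal ι lay Ω v₀, walkEps ι lay l₀ v₀, N, lam, pp, hN, hm, ?_, hlam, ?_, ?_, ?_⟩
  · intro a b l
    exact natAbs_walkEpsP_le_one lay l₀ v₀ _ _ l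
  · intro j
    refine isDominant_walkTerm lay l₀ v₀ ι d Ω (lam j) hT (hwalk j) (hΩj j) fun y' hy' hne' => ?_
    have hw' : (List.ofFn fun s : Fin T => y' s.succ) ≠ wstar j := by
      intro h
      apply hne'
      exact eq_of_ofFn_eq (hy'.1.trans (hy0 j).symm) (h.trans (hyw j).symm)
    have h1 := hmarg j _ hw'
    rw [← hy'.1, walkCost_ofFn d (lam j) g y' hy'.2] at h1
    · rw [hcostFin]
      have := WithTop.coe_le_coe.mp h1
      exact this
  · intro j
    rw [alternate_walkTerm_iff lay l₀ v₀ ι hT (hwalk _) (hwalk _), hsgnFin, hsgnFin]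
    simp only [Fin.val_castSucc, Fin.val_succ, pow_succ]
    have : ((-1 : ℤ) ^ (j : ℕ)) * ((-1 : ℤ) ^ (j : ℕ)) = 1 := by rw [← mul_pow]; norm_num
    nlinarith
  · -- the incidence count: diagonal + ≤ 2W per layer + W back entries
    have h1 := card_support_walkEps_le ι lay l₀ v₀
    have h2 : ∀ t : Fin T, ((univ : Finset ((Fin (2 ^ L * n) × Bool) × (Fin (2 ^ L * n) × Bool))).filter
        (fun vv => (lay t vv.1 vv.2).isSome)).card ≤ 2 * W := by
      intro t
      have hmem : lay t ∈ (gad n L L 0).map (finLayer (2 ^ L * n)) := by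
        rw [← hgdef, hlay]; exact List.get_mem g t
      obtain ⟨lay', hlay', hEq⟩ := List.mem_map.mp hmem
      rw [← hEq, hW]
      exact card_edges_staircase_layer_le n L (2 ^ L * n) L 0 lay' hlay'
    have h3 : ∑ t : Fin T, ((univ : Finset ((Fin (2 ^ L * n) × Bool) × (Fin (2 ^ L * n) × Bool))).filter
        (fun vv => (lay t vv.1 vv.2).isSome)).card ≤ T * (2 * W) := by
      calc ∑ t : Fin T, ((univ : Finset ((Fin (2 ^ L * n) × Bool) × (Fin (2 ^ L * n) × Bool))).filter
            (fun vv => (lay t vv.1 vv.2).isSome)).card ≤ ∑ _t : Fin T, 2 * W := sum_le_sum fun t _ => h2 t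
        _ = T * (2 * W) := by rw [sum_const, card_univ, Fintype.card_fin, smul_eq_mul]
    have h4 : W = 2 ^ L * n * 2 := by rw [hW]; exact hWval
    calc ((univ : Finset (Fin ((T + 1) * W) × Fin ((T + 1) * W) × Fin (L + 1))).filter
          (fun x => walkEps ι lay l₀ v₀ x.1 x.2.1 x.2.2 ≠ 0)).card
        ≤ (T + 1) * W + T * (2 * W) + W := by have := h1; rw [← hW] at this; omega
      _ = (3 * T + 2) * W := by ring
      _ = (3 * ((2 ^ L - 1) * (n + 1)) + 2) * (2 ^ L * n * 2) := by rw [← hlen, h4]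

end Staircase

/-! ## 4. `K = 4`: for every `C` a design whose alternating chain beats `C` times its number of present incidences -/

/-- the `K = 4` staircase (`L = 3`): `n³` alternating dominant terms on at most `336n² + 368n` present incidences. -/
theorem staircase_four (n : ℕ) (hn : 2 ≤ n) (he : Even n) :
    ∃ (m : ℕ) (d : Fin 4 → ℕ) (v ε : Fin m → Fin m → Fin 4 → ℤ) (N : ℕ) (θ : Fin (N + 1) → ℤ)
      (p : Fin (N + 1) → Equiv.Perm (Fin m) × (Fin m → Fin 4)),
      (∀ i j l, (ε i j l).natAbs ≤ 1) ∧ StrictMono θ ∧ (∀ k, IsDominant d v ε (θ k) (p k)) ∧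
      (∀ k : Fin N, termSign ε (p k.castSucc) * termSign ε (p k.succ) < 0) ∧ N + 1 = n ^ 3 ∧
      ((univ : Finset (Fin m × Fin m × Fin 4)).filter (fun x => ε x.1 x.2.1 x.2.2 ≠ 0)).card ≤ 336 * n ^ 2 + 368 * n := by
  obtain ⟨m, d, v, ε, N, θ, p, hN, _, hε, hθ, hdom, halt, hcard⟩ := staircase_design n 3 hn he (by norm_num)
  refine ⟨m, d, v, ε, N, θ, p, hε, hθ, hdom, halt, hN, ?_⟩
  have h7 : (3 * ((2 ^ 3 - 1) * (n + 1)) + 2) * (2 ^ 3 * n * 2) = 336 * n ^ 2 + 368 * n := by norm_num; ring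
  rw [h7] at hcard
  exact hcard

/-- the closing arithmetic: with `n = 800(C+1)`, `C·(336n² + 368n) < n³ − 1`. -/
theorem final_arith (C n : ℕ) (hn : n = 800 * (C + 1)) (N : ℕ) (hN : N + 1 = n ^ 3) (I : ℕ)
    (hI : I ≤ 336 * n ^ 2 + 368 * n) : C * I < N := by
  have hn1 : 1 ≤ n := by omega
  have hsq : n ≤ n ^ 2 := by nlinarith
  have hA : C * (336 * n ^ 2 + 368 * n) ≤ 704 * C * n ^ 2 := by nlinarith
  have hB : n ^ 3 = 800 * (C + 1) * n ^ 2 := by subst hn; ring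
  have hpos : 1 ≤ n ^ 2 := by nlinarith
  have key : C * (336 * n ^ 2 + 368 * n) + 1 < n ^ 3 := by
    rw [hB]; nlinarith [hA, hpos, Nat.zero_le (C * n ^ 2)]
  have h1 : C * I ≤ C * (336 * n ^ 2 + 368 * n) := Nat.mul_le_mul_left _ hI
  omega

/-- **INCIDENCE-LINEAR LAWS ARE FALSE AT `K = 4`.**  For every `C` there is a dominance design of some format `(m, 4)` (the staircase with
`L = 3`, `n = 800(C+1)`) carrying a sign-alternating chain of dominant terms at strictly increasing integer slopes whose number of alternations
`N` exceeds `C` times the number of present incidences of the design. -/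
theorem exists_chain_gt_mul_card_incidences (C : ℕ) :
    ∃ (m : ℕ) (d : Fin 4 → ℕ) (v ε : Fin m → Fin m → Fin 4 → ℤ) (N : ℕ) (θ : Fin (N + 1) → ℤ)
      (p : Fin (N + 1) → Equiv.Perm (Fin m) × (Fin m → Fin 4)),
      (∀ i j l, (ε i j l).natAbs ≤ 1) ∧ StrictMono θ ∧ (∀ k, IsDominant d v ε (θ k) (p k)) ∧
      (∀ k : Fin N, termSign ε (p k.castSucc) * termSign ε (p k.succ) < 0) ∧
      C * ((univ : Finset (Fin m × Fin m × Fin 4)).filter (fun x => ε x.1 x.2.1 x.2.2 ≠ 0)).card < N := by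
  obtain ⟨m, d, v, ε, N, θ, p, hε, hθ, hdom, halt, hN, hcard⟩ :=
    staircase_four (800 * (C + 1)) (by omega) ⟨400 * (C + 1), by ring⟩
  exact ⟨m, d, v, ε, N, θ, p, hε, hθ, hdom, halt, final_arith C _ rfl N hN _ hcard⟩

end StaircaseIncidences

end Summit.ValiantsHypothesis.ValiantsHypothesis.Theorems.KPlusLogSqLaw
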